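import Summits.KontsevichZagierPeriods.KontsevichZagierPeriods.Theses.LiftingCriteria
import Summits.KontsevichZagierPeriods.KontsevichZagierPeriods.Theorems.LiftingCriteriaDilationLiftAtOneSingleGenerator
import Summits.KontsevichZagierPeriods.KontsevichZagierPeriods.Theorems.LiftingCriteriaDilationLiftAtOneLocalPurityAtOne
import Summits.KontsevichZagierPeriods.KontsevichZagierPeriods.Theorems.LiftingCriteriaDilationLiftAtOneTwistedDiagonal
import Summits.KontsevichZagierPeriods.KontsevichZagierPeriods.Theorems.LiftingCriteriaDilationLiftAtOneLiouville

/-!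
# `DilationLiftAtOne` (stmt-KontsevichZagierPeriods-3571, route LiftingCriteria, rank 2) — line `dimone-asgt`
# (forward ladder G4, unit fwd-ladder-KontsevichZagierPeriods-52, 2026-08-17): the DIMENSION-ONE RUNG

Forward discipline (G4): the crux `DilationLiftAtOne` is the summit in pencil coordinates
(`Lines/registered_structure.lean`: `DilationLiftAtOne ↔ KZCube ∧ MovesLift` given `DilationTransfer`;
tribunal: summit-strength, T3 rungs only where S is proved). This line does NOT attack the crux head-on:
it types the NEXT RUNG of the crux's own graded family and registers its two-stub skeleton, keeping the
registered bet `stub_glueAtOne` verbatim as the gap.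

GRADATION (the crux in its own language). Primary parameter `N = max nᵢ` (cube dimension of the Nash
data; the crux is `∀ N`; S-content grows with `N`). Inside `N = 1` the secondary parameter is the CLASS of
the one-variable integrand `h` (by its antiderivative / the genus of `y = h(x)`):
`ℚ(x)` (PROVED p161775) ⊂ LIOUVILLE normal form = elementary antiderivative ⊇ genus 0 (PROVED p166809,
`stub_liouvilleSector`, the FLOOR `θ₀`; group `𝔾_a × 𝔾_m^A`, Baker) ⊂ ALL Nash `h`, any genus (the RUNG
`θ₁ = DilationLiftAtOneDimOne` below; groups `𝔾_a × Π J_𝔪`, ASGT). Inside `N = 2`: the `x₀`-exact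
rational sector is PROVED (p163914, Stokes descent); general two-variable data (ζ(2), `Li₂`, surface
periods, quadratic relations of 1-periods) is GPC-strength = `gap_after`.

THE RUNG (`rung_decl = …DimOneAsgt.DilationLiftAtOneDimOne`, family `DimOneLiftOn adm`): for `h` Nash on
`(a,b) ⊇ [0,1]` with `∫₀¹ h = 0`, `v_h ∈ (ϖ − 1)(ℝ_alg[ϖ] + Σ ℝ_alg[ϖ]·D)` on `[0,1]` — the floor with ONE
hypothesis generalised (elementary antiderivative ↦ arbitrary abelian integral). On-path: `crux → rung` is
`dimOne_of_dilationLiftAtOne` (proved below, instantiation `S = n = 1`). Floor: `dimOneLiftOn_liouville :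
DimOneLiftOn IsLiouvilleData` (proved below from the landed `dilationLiftAtOne_liouvilleSector`; witness =
`Summit.KontsevichZagierPeriods.LiftingCriteria.DilationLiftAtOne.stub_liouvilleSector`). `rung → crux`,
`rung → KontsevichZagierPeriods`, `floor → rung`, `stub → rung/crux/summit` all FAIL the cheap batteries
(probe file `Lines/dimone_asgt_probe.lean`). Witness regime: genus ≥ 1 one-variable data = planar areas
bounded by elliptic / hyperelliptic arcs, where S is NOT known in the tree (`LowDimension.PlanarAreas`,
stmt-…-4990, open) nor in print as a KZ-rules statement (Huber–Wüstholz 2022 Thm 13.3 is the Nori /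
1-motive formulation); the rational sub-floor sits inside S's known regime (`LowdimBaker0DimLeOne`).

THE LOCATED ATTACK (lead c1 GLUE-ANALYSIS §4, lead c2 §3quater/§5(b) — recommended for filing, not filed
before): the floor proof (`baker_decomposition_complex`) stops exactly where abelian integrals of genus ≥ 1
begin; there Baker is replaced by Wüstholz's analytic subgroup theorem. `F(ϖ) = ϖ v_h(ϖ) = ∫₀^ϖ h` is
`λ∘L` for the Abel–Jacobi path in `G = 𝔾_a × Π J_𝔪ᵢ`; `F(1) = 0` and ASGT give an algebraic `Z_u` with
`λ|Lie Z_u = 0`, and in `G/Z_u` the Nash path becomes a NULL-HOMOTOPIC Nash LOOP; the division trick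
`R_n = exp(L''/n)` puts it in one algebraic chart, and the straight-line homotopy to the constant loop IS a
twisted-diagonal kernel: `w/(ϖ − 1) = −n·T[κ]`, `κ(ϖ,x) = Σ_j a_j((1−ϖ)ρ_n(ϖ)x) ρ_{n,j}(ϖ)` — a kernel of
cube dimension ONE for every genus. Stub N1 = the factorisation (transcendence), stub N2 = the kernel
lemma (real analysis, provable now), S4 landed.

SIDE PAYOFF toward S (why the rung is in the direction of the Statement): planar areas and all
one-dimensional representations reduce UNCONDITIONALLY to dimension-one cube–Nash data
(`LiftingCriteriaCubeNashNormalFormDimLeOne.cubeNashNormalForm_dim_le_one`), so rung + `DilationTransfer`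
restricted to dimension-one data with the rung's TWO-dimensional kernel witnesses (`G = ∂₀(x₀K)`,
`d = 2`; the landed `stub_dilationTransferDimLeOne` covers witnesses of dimension ≤ 1 only, so this
transfer instance is the dimension-2 case of crux stmt-…-3572, open) gives KZ-equivalence on the
planar-areas territory of `LowDimension.PlanarAreas` (stmt-…-4990, open) / `AbelContraction` — ONE
transcendence input in the pencil instead of a generator-by-generator transfer of Huber–Wüstholz's
relations into real semialgebraic moves.

LADDER CEILING (BC9): method family = analytic subgroup theorem / linear forms in (abelian) logarithms /
1-motives (Huber–Wüstholz); ceiling = capped at cohomological degree one (linear relations of 1-periods):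
periods of `H^N`, `N ≥ 2`, and quadratic relations of 1-periods are outside the method (Huber–Wüstholz 2022,
Introduction and §13; barrier files `GrothendieckPeriodConjectureDependence*.lean`); the lift past the
ceiling is André's generalized period conjecture in degree ≥ 2 = the bet `stub_glueAtOne` — so the rung is
the LAST rung of this family (disposition: frontier), and it is banked as such.

Registered stubs: `stub_nullLoopFactorisation` (N1, L+, ASGT), `stub_straightPathKernel` (N2, M, provable
now), `stub_glueAtOne` (S3, the registered bet verbatim = dimension ≥ 2). `DilationLiftAtOne_of` concludes
the crux BY NAME; sorries only inside the three stubs.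
-/

noncomputable section

-- `Summit.KontsevichZagierPeriods.KontsevichZagierPeriods.…` is the tree's mandated layout (single-conjunct summit).
set_option linter.dupNamespace false

namespace Summit.KontsevichZagierPeriods.KontsevichZagierPeriods.Cruxes.DilationLiftAtOne.DimOneAsgt

open scoped BigOperators
open MeasureTheory Set
open Summit.KontsevichZagierPeriods.KontsevichZagierPeriods.Theses.LiftingCriteria (DilationLiftAtOne)

/-- **Graded family of the ladder inside dimension one.** `DimOneLiftOn adm`: for every
one-variable datum `h` of the admissibility class `adm` which is Nash (`ℚ`-semialgebraic and
real-analytic) on an interval `(a,b) ⊇ [0,1]` and has `∫₀¹ h = 0`, the dilation function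
`v_h(ϖ) = ∫₀¹ h(ϖ x) dx` lifts on `[0,1]` in the crux's own format:
`v_h = (ϖ − 1)·(μ₀ + Σ_j μ_j v_{G_j})` with Nash cube functions `G_j` and polynomials `μ` with real
algebraic coefficients. Monotone in `adm`. Floor `adm = IsLiouvilleData` (landed, p166809); rung
`adm = ⊤` (`DilationLiftAtOneDimOne`). [cite: KontsevichZagier2001, §1.2] -/
def DimOneLiftOn (adm : ℝ → ℝ → (ℝ → ℝ) → Prop) : Prop :=
  ∀ (a b : ℝ), a < 0 → 1 < b → ∀ (h : ℝ → ℝ), adm a b h → Literature.NumberTheory.Transcendental.IsSemialgebraicFunOn ℚ {t : Fin 1 → ℝ | t 0 ∈ Set.Ioo a b} (fun t => h (t 0)) → (∀ x ∈ Set.Ioo a b, AnalyticAt ℝ h x) → (∫ z in Set.pi Set.univ (fun _ : Fin 1 => Set.Icc (0:ℝ) 1), h (((1:ℝ) • z) 0)) = 0 → ∃ (T : ℕ) (d : Fin T → ℕ) (G : (j : Fin T) → (Fin (d j) → ℝ) → ℝ) (V : (j : Fin T) → Set (Fin (d j) → ℝ)) (μ : Fin T → Polynomial ℝ) (μ₀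 : Polynomial ℝ), (∀ j, IsOpen (V j) ∧ Set.pi Set.univ (fun _ : Fin (d j) => Set.Icc (0:ℝ) 1) ⊆ (V j) ∧ Literature.NumberTheory.Transcendental.IsSemialgebraicFunOn ℚ (V j) (G j) ∧ AnalyticOnNhd ℝ (G j) (V j)) ∧ (∀ j k, IsAlgebraic ℚ ((μ j).coeff k)) ∧ (∀ k, IsAlgebraic ℚ (μ₀.coeff k)) ∧ ∀ ϖ ∈ Set.Icc (0:ℝ) 1, (∫ z in Set.pi Set.univ (fun _ : Fin 1 => Set.Icc (0:ℝ) 1), h ((ϖ • z) 0)) = (ϖ - 1) * (μ₀.eval ϖ + ∑ j, (μ j).eval ϖ * (∫ z in Set.pi Set.univ (fun _ : Fin (d j) => Set.Icc (0:ℝ) 1), G j (ϖ • z)))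

/-- **Floor class θ₀ (PROVED, p166809 `stub_liouvilleSector`)**: one-variable data in LIOUVILLE
normal form `h = N' + Σ_k Re(c_k w_k'/w_k)` with Nash `N`, Nash loops `w_k = u_k + i v_k` in the slit
plane and algebraic `c_k = γ_k + i δ_k` — every algebraic integrand with ELEMENTARY antiderivative
(⊇ genus-0 data ⊇ `ℚ(x)`); its periods are `ℚ̄`-linear forms in logarithms of algebraic numbers
(group `𝔾_a × 𝔾_m^A`). [cite: Baker1975, Thm. 2.1] -/
def IsLiouvilleData (a b : ℝ) (h : ℝ → ℝ) : Prop :=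
  ∃ (N : ℝ → ℝ) (A : ℕ) (u v : Fin A → ℝ → ℝ) (γ δ : Fin A → ℝ),
    Literature.NumberTheory.Transcendental.IsSemialgebraicFunOn ℚ {t : Fin 1 → ℝ | t 0 ∈ Set.Ioo a b} (fun t => N (t 0)) ∧ (∀ x ∈ Set.Ioo a b, AnalyticAt ℝ N x) ∧
    (∀ k, Literature.NumberTheory.Transcendental.IsSemialgebraicFunOn ℚ {t : Fin 1 → ℝ | t 0 ∈ Set.Ioo a b} (fun t => u k (t 0))) ∧
    (∀ k, Literature.NumberTheory.Transcendental.IsSemialgebraicFunOn ℚ {t : Fin 1 → ℝ | t 0 ∈ Set.Ioo a b} (fun t => v k (t 0))) ∧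
    (∀ k, ∀ x ∈ Set.Ioo a b, AnalyticAt ℝ (u k) x) ∧ (∀ k, ∀ x ∈ Set.Ioo a b, AnalyticAt ℝ (v k) x) ∧
    (∀ k, ∀ x ∈ Set.Ioo a b, 0 < u k x ∨ v k x ≠ 0) ∧ (∀ k, IsAlgebraic ℚ (γ k)) ∧ (∀ k, IsAlgebraic ℚ (δ k)) ∧
    h = fun x => deriv N x + ∑ k, (γ k * ((deriv (u k) x * u k x + deriv (v k) x * v k x) / (u k x ^ 2 + v k x ^ 2)) - δ k * ((deriv (v k) x * u k x - deriv (u k) x * v k x) / (u k x ^ 2 + v k x ^ 2)))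

/-- **THE RUNG θ₁ (next statement of the ladder, OPEN — filed here as a line, not as an item):
`DilationLiftAtOne` for ALL one-variable Nash data (any genus of the underlying curve).** For `h`
Nash on `(a,b) ⊇ [0,1]` with `∫₀¹ h = 0`, `v_h ∈ (ϖ − 1)·(ℝ_alg[ϖ] + Σ ℝ_alg[ϖ]·D)` on `[0,1]`.
One hypothesis of the floor generalised (elementary antiderivative ↦ arbitrary abelian integral);
the crux `DilationLiftAtOne` is this for Nash data of EVERY dimension (`dimOne_of_dilationLiftAtOne`
below is the on-path certificate `crux → rung`). Located attack: Wüstholz's analytic subgroup theorem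
makes the Nash loop null-homotopic in a quotient group, and a straight-line homotopy in an algebraic
chart is a twisted-diagonal kernel (stubs N1, N2 below). [cite: HuberWuestholz2022, Thm. 13.3] -/
def DilationLiftAtOneDimOne : Prop :=
  DimOneLiftOn (fun _ _ _ => True)

/-! ### Registered stubs of the line -/

/-- **Stub N1 — null-loop factorisation (the transcendence input; L+; source: Wüstholz's analytic
subgroup theorem 1989 + generalized Jacobians, Huber–Wüstholz 2022 Part III).** For `h` Nash on
`(a,b) ⊇ [0,1]` with `∫₀¹ h = 0`, the abelian integral `F(ϖ) = ∫₀^ϖ h = ϖ·v_h(ϖ)` factors on `[0,1]`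
as `F = Φ_A ∘ ζ`: `ζ(ϖ) = ϖ(1−ϖ)ρ(ϖ)` a Nash LOOP at `0 ∈ ℝ^k` (`ρ` Nash near `[0,1]`), and
`Φ_A(z) = ∫_[0,z] Σ_j A_j dz_j = ∫₀¹ ⟨A(sz), z⟩ ds` the radial line integral of a Nash 1-form `A` on an
open `W` star-containing the whole pencil `[0,1]·ρ(ϖ)`. Intended proof (lead c1, GLUE-ANALYSIS §4):
`F = λ∘L` for the Abel–Jacobi path in `G = 𝔾_a × Π J_𝔪ᵢ` (generalized Jacobians of the curves
`y = h_i(x)` over `ℚ̄ ∩ ℝ`); `F(1) = 0` reads `λ(u) = 0`, `exp u ∈ G(ℚ̄)`; ASGT gives an algebraic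
`Z ∋ u` (real, by minimality) with `λ|Lie Z = 0`; in `G'' = G/Z` the path closes up and is
null-homotopic (`L''(0) = L''(1) = 0`); division trick `R_n = exp(L''/n)` (Nash: a connected component of
the semialgebraic étale cover `n·R = Q''`) brings the loop into ONE algebraic chart at `e`, where
`ω_λ'' = Σ a_j dz_j`, `A = n·a`, `ρ = ρ_n → 0` uniformly. Trivial exactly on the exact sector (`F` Nash:
`k = 1`, `A = 1`). Not in tree: general ASGT (only `analyticSubgroupTheorem_GaGmE`), generalized
Jacobians. [cite: HuberWuestholz2022, Thm. 13.3] -/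
theorem stub_nullLoopFactorisation :
    ∀ (a b : ℝ), a < 0 → 1 < b → ∀ (h : ℝ → ℝ), Literature.NumberTheory.Transcendental.IsSemialgebraicFunOn ℚ {t : Fin 1 → ℝ | t 0 ∈ Set.Ioo a b} (fun t => h (t 0)) → (∀ x ∈ Set.Ioo a b, AnalyticAt ℝ h x) → (∫ z in Set.pi Set.univ (fun _ : Fin 1 => Set.Icc (0:ℝ) 1), h (((1:ℝ) • z) 0)) = 0 → ∃ (k : ℕ) (A : (Fin k → ℝ) → Fin k → ℝ) (W : Set (Fin k → ℝ)) (ρ : ℝ → Fin k → ℝ) (a' b' : ℝ), a' < 0 ∧ 1 < b' ∧ IsOpen W ∧ (∀ j, Literature.NumberTheory.Transcendental.IsSemialgebraicFunOn ℚ W (fun z => A z j)) ∧ (∀ j, AnalyticOnNhd ℝ (fun z => A z j) W) ∧ (∀ j, Literature.NumberTheory.Transcendental.IsSemialgebraicFunOn ℚ {t : Fin 1 → ℝ | t 0 ∈ Set.Ioo a' b'} (fun t => ρ (t 0) j)) ∧ (∀ j, ∀ x ∈ Set.Ioo a' b', AnalyticAt ℝ (fun x => ρ x j) x) ∧ (∀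 ϖ ∈ Set.Ioo a' b', ∀ t ∈ Set.Icc (0:ℝ) 1, t • ρ ϖ ∈ W) ∧ ∀ ϖ ∈ Set.Icc (0:ℝ) 1, ϖ * (∫ z in Set.pi Set.univ (fun _ : Fin 1 => Set.Icc (0:ℝ) 1), h ((ϖ • z) 0)) = ∫ s in (0:ℝ)..1, ∑ j, A (s • ((ϖ * (1 - ϖ)) • ρ ϖ)) j * ((ϖ * (1 - ϖ)) * ρ ϖ j) := by
  sorry

/-- **Stub N2 — straight-path kernel lemma (real analysis, provable NOW, M).** If `ϖ·v_h(ϖ)` is the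
radial line integral of a Nash 1-form `A` (on `W`) up to the point `ϖ(1−ϖ)ρ(ϖ)` of a reduced Nash
loop `ρ` with `[0,1]·ρ(ϖ) ⊂ W` near `[0,1]`, then `v_h ∈ (ϖ − 1)·D'`:
`v_h(ϖ) = (ϖ − 1) ∫₀¹ K(ϖ, ϖy) dy` with the kernel `K(p₀,p₁) = −⟨A((p₁(1−p₀))•ρ(p₀)), ρ(p₀)⟩`, Nash on
the open set `{p₀ ∈ (a',b'), (p₁(1−p₀))•ρ(p₀) ∈ W} ⊇ [0,1] × [0,1]` (substitution `s = y`; the point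
`ϖ = 0` by continuity of both sides — `h` continuous on `[0,1]`). No closedness of `A` is needed.
[cite: KontsevichZagier2001, §1.2] -/
theorem stub_straightPathKernel :
    ∀ (k : ℕ) (A : (Fin k → ℝ) → Fin k → ℝ) (W : Set (Fin k → ℝ)) (ρ : ℝ → Fin k → ℝ) (a' b' : ℝ), a' < 0 → 1 < b' → IsOpen W → (∀ j, Literature.NumberTheory.Transcendental.IsSemialgebraicFunOn ℚ W (fun z => A z j)) → (∀ j, AnalyticOnNhd ℝ (fun z => A z j) W) → (∀ j, Literature.NumberTheory.Transcendental.IsSemialgebraicFunOn ℚ {t : Fin 1 → ℝ | t 0 ∈ Set.Ioo a' b'} (fun t => ρ (t 0) j)) → (∀ j, ∀ x ∈ Set.Ioo a' b', AnalyticAt ℝ (fun x => ρ x j) x) → (∀ ϖ ∈ Set.Ioo a' b', ∀ t ∈ Set.Icc (0:ℝ) 1, t • ρ ϖ ∈ W) → ∀ (h : ℝ → ℝ), ContinuousOn h (Set.Icc (0:ℝ) 1) → (∀ ϖ ∈ Set.Icc (0:ℝ) 1, ϖ * (∫ z in Set.pi Set.univ (fun _ : Fin 1 => Set.Icc (0:ℝ)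 1), h ((ϖ • z) 0)) = ∫ s in (0:ℝ)..1, ∑ j, A (s • ((ϖ * (1 - ϖ)) • ρ ϖ)) j * ((ϖ * (1 - ϖ)) * ρ ϖ j)) → ∃ (K : (Fin 2 → ℝ) → ℝ) (V : Set (Fin 2 → ℝ)), IsOpen V ∧ (∀ ϖ ∈ Set.Icc (0:ℝ) 1, ∀ x ∈ Set.pi Set.univ (fun _ : Fin 1 => Set.Icc (0:ℝ) 1), Matrix.vecCons ϖ x ∈ V) ∧ Literature.NumberTheory.Transcendental.IsSemialgebraicFunOn ℚ V K ∧ AnalyticOnNhd ℝ K V ∧ ∀ ϖ ∈ Set.Icc (0:ℝ) 1, (∫ z in Set.pi Set.univ (fun _ : Fin 1 => Set.Icc (0:ℝ) 1), h ((ϖ • z) 0)) = (ϖ - 1) * ∫ y in Set.pi Set.univ (fun _ : Fin 1 => Set.Icc (0:ℝ) 1), K (Matrix.vecCons ϖ (ϖ • y)) := by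
  sorry

/-- **Stub S3 — glue at `ϖ = 1` (THE REGISTERED BET of line `registered`, verbatim; crux-equivalent,
GPC-strength; = `gap_after` of the ladder: Nash data of dimension ≥ 2).** Kept so that the skeleton
concludes the crux by name for data not representable in dimension one. [cite: KontsevichZagier2001, §1.2] -/
theorem stub_glueAtOne :
    ∀ (N : ℕ) (h : (Fin N → ℝ) → ℝ) (W : Set (Fin N → ℝ)), IsOpen W → Set.pi Set.univ (fun _ : Fin N => Set.Icc (0:ℝ) 1) ⊆ W → Literature.NumberTheory.Transcendental.IsSemialgebraicFunOn ℚ W h → AnalyticOnNhd ℝ h W → ∀ (ε : ℝ) (d₁ : ℕ) (K₁ : (Fin (d₁ + 1) → ℝ) → ℝ) (V₁ : Set (Fin (d₁ + 1) → ℝ)), 0 < ε → IsOpen V₁ → (∀ ϖ ∈ Set.Ioc (1 - ε) 1, ∀ x ∈ Set.pi Set.univ (fun _ : Fin d₁ => Set.Icc (0:ℝ) 1), Matrix.vecCons ϖ x ∈ V₁) → Literature.NumberTheory.Transcendental.IsSemialgebraicFunOn ℚ V₁ K₁ → AnalyticOnNhd ℝ K₁ V₁ → (∀ ϖ ∈ Set.Ioc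 (1 - ε) 1, (∫ z in Set.pi Set.univ (fun _ : Fin N => Set.Icc (0:ℝ) 1), h (ϖ • z)) = (ϖ - 1) * ∫ y in Set.pi Set.univ (fun _ : Fin d₁ => Set.Icc (0:ℝ) 1), K₁ (Matrix.vecCons ϖ (ϖ • y))) → ∃ (d : ℕ) (K : (Fin (d + 1) → ℝ) → ℝ) (V : Set (Fin (d + 1) → ℝ)), IsOpen V ∧ (∀ ϖ ∈ Set.Icc (0:ℝ) 1, ∀ x ∈ Set.pi Set.univ (fun _ : Fin d => Set.Icc (0:ℝ) 1), Matrix.vecCons ϖ x ∈ V) ∧ Literature.NumberTheory.Transcendental.IsSemialgebraicFunOn ℚ V K ∧ AnalyticOnNhd ℝ K V ∧ ∀ ϖ ∈ Set.Icc (0:ℝ) 1, (∫ z in Set.pi Set.univ (fun _ : Fin N => Set.Icc (0:ℝ) 1), h (ϖ • z)) = (ϖ - 1) * ∫ y in Set.pi Set.univ (fun _ : Fin d => Set.Icc (0:ℝ) 1), K (Matrix.vecCons ϖ (ϖ • y)) := by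
  sorry

/-! ### Compositions (no `sorry` below this line) -/

/-- **The rung from N1, N2 and the landed S4** (explicit hypotheses; witness `T = 1`, `d = 2`,
`μ = 1`, `μ₀ = 0`). [cite: KontsevichZagier2001, §1.2] -/
theorem DilationLiftAtOneDimOne_of_stubs
    (h₁ : ∀ (a b : ℝ), a < 0 → 1 < b → ∀ (h : ℝ → ℝ), Literature.NumberTheory.Transcendental.IsSemialgebraicFunOn ℚ {t : Fin 1 → ℝ | t 0 ∈ Set.Ioo a b} (fun t => h (t 0)) → (∀ x ∈ Set.Ioo a b, AnalyticAt ℝ h x) → (∫ z in Set.pi Set.univ (fun _ : Fin 1 => Set.Icc (0:ℝ) 1), h (((1:ℝ) • z) 0)) = 0 → ∃ (k : ℕ) (A : (Fin k → ℝ) → Fin k → ℝ) (W : Set (Fin k → ℝ)) (ρ : ℝ → Fin k → ℝ) (a' b' : ℝ), a' < 0 ∧ 1 < b' ∧ IsOpen W ∧ (∀ j, Literature.NumberTheory.Transcendental.IsSemialgebraicFunOn ℚ W (fun z => A z j)) ∧ (∀ j, AnalyticOnNhd ℝ (fun z => A z j) W) ∧ (∀ j, Literature.NumberTheory.Transcendental.IsSemialgebraicFunOn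 ℚ {t : Fin 1 → ℝ | t 0 ∈ Set.Ioo a' b'} (fun t => ρ (t 0) j)) ∧ (∀ j, ∀ x ∈ Set.Ioo a' b', AnalyticAt ℝ (fun x => ρ x j) x) ∧ (∀ ϖ ∈ Set.Ioo a' b', ∀ t ∈ Set.Icc (0:ℝ) 1, t • ρ ϖ ∈ W) ∧ ∀ ϖ ∈ Set.Icc (0:ℝ) 1, ϖ * (∫ z in Set.pi Set.univ (fun _ : Fin 1 => Set.Icc (0:ℝ) 1), h ((ϖ • z) 0)) = ∫ s in (0:ℝ)..1, ∑ j, A (s • ((ϖ * (1 - ϖ)) • ρ ϖ)) j * ((ϖ * (1 - ϖ)) * ρ ϖ j))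
    (h₂ : ∀ (k : ℕ) (A : (Fin k → ℝ) → Fin k → ℝ) (W : Set (Fin k → ℝ)) (ρ : ℝ → Fin k → ℝ) (a' b' : ℝ), a' < 0 → 1 < b' → IsOpen W → (∀ j, Literature.NumberTheory.Transcendental.IsSemialgebraicFunOn ℚ W (fun z => A z j)) → (∀ j, AnalyticOnNhd ℝ (fun z => A z j) W) → (∀ j, Literature.NumberTheory.Transcendental.IsSemialgebraicFunOn ℚ {t : Fin 1 → ℝ | t 0 ∈ Set.Ioo a' b'} (fun t => ρ (t 0) j)) → (∀ j, ∀ x ∈ Set.Ioo a' b', AnalyticAt ℝ (fun x => ρ x j) x) → (∀ ϖ ∈ Set.Ioo a' b', ∀ t ∈ Set.Icc (0:ℝ) 1, t • ρ ϖ ∈ W) → ∀ (h : ℝ → ℝ), ContinuousOn h (Set.Icc (0:ℝ) 1) → (∀ ϖ ∈ Set.Icc (0:ℝ) 1, ϖ * (∫ z in Set.pi Set.univ (fun _ : Fin 1 => Set.Icc (0:ℝ) 1), h ((ϖ • z) 0)) = ∫ s in (0:ℝ)..1, ∑ j, A (s • ((ϖ * (1 - ϖ)) • ρ ϖ)) j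 * ((ϖ * (1 - ϖ)) * ρ ϖ j)) → ∃ (K : (Fin 2 → ℝ) → ℝ) (V : Set (Fin 2 → ℝ)), IsOpen V ∧ (∀ ϖ ∈ Set.Icc (0:ℝ) 1, ∀ x ∈ Set.pi Set.univ (fun _ : Fin 1 => Set.Icc (0:ℝ) 1), Matrix.vecCons ϖ x ∈ V) ∧ Literature.NumberTheory.Transcendental.IsSemialgebraicFunOn ℚ V K ∧ AnalyticOnNhd ℝ K V ∧ ∀ ϖ ∈ Set.Icc (0:ℝ) 1, (∫ z in Set.pi Set.univ (fun _ : Fin 1 => Set.Icc (0:ℝ) 1), h ((ϖ • z) 0)) = (ϖ - 1) * ∫ y in Set.pi Set.univ (fun _ : Fin 1 => Set.Icc (0:ℝ) 1), K (Matrix.vecCons ϖ (ϖ • y)))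
    (h₄ : ∀ (d : ℕ) (K : (Fin (d + 1) → ℝ) → ℝ) (V : Set (Fin (d + 1) → ℝ)), IsOpen V → (∀ ϖ ∈ Set.Icc (0:ℝ) 1, ∀ x ∈ Set.pi Set.univ (fun _ : Fin d => Set.Icc (0:ℝ) 1), Matrix.vecCons ϖ x ∈ V) → Literature.NumberTheory.Transcendental.IsSemialgebraicFunOn ℚ V K → AnalyticOnNhd ℝ K V → ∃ (G : (Fin (d + 1) → ℝ) → ℝ) (V' : Set (Fin (d + 1) → ℝ)), (IsOpen V' ∧ Set.pi Set.univ (fun _ : Fin (d + 1) => Set.Icc (0:ℝ) 1) ⊆ V' ∧ Literature.NumberTheory.Transcendental.IsSemialgebraicFunOn ℚ V' G ∧ AnalyticOnNhd ℝ G V') ∧ ∀ ϖ ∈ Set.Icc (0:ℝ) 1, (∫ y in Set.pi Set.univ (fun _ : Fin d => Set.Icc (0:ℝ) 1), K (Matrix.vecCons ϖ (ϖ • y))) = ∫ y' in Set.pi Set.univ (fun _ : Fin (d + 1) => Set.Icc (0:ℝ) 1), G (ϖ • y')) :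
    DilationLiftAtOneDimOne := by
  intro a b ha hb h _ hs han h1
  obtain ⟨k, A, W, ρ, a', b', ha', hb', hWo, hAs, hAa, hρs, hρa, hseg, hF⟩ := h₁ a b ha hb h hs han h1
  -- `h` is continuous on `[0,1] ⊆ (a,b)` (analytic there)
  have hcont : ContinuousOn h (Set.Icc (0:ℝ) 1) := fun x hx =>
    (han x ⟨ha.trans_le hx.1, hx.2.trans_lt hb⟩).continuousAt.continuousWithinAt
  obtain ⟨K, V, hVo, hVc, hKs, hKa, hid⟩ :=
    h₂ k A W ρ a' b' ha' hb' hWo hAs hAa hρs hρa hseg h hcont hF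
  obtain ⟨G, V', hG, hGK⟩ := h₄ 1 K V hVo hVc hKs hKa
  refine ⟨1, fun _ => 1 + 1, fun _ => G, fun _ => V', fun _ => 1, 0, fun _ => hG, ?_, ?_, ?_⟩
  · intro j k
    rw [Polynomial.coeff_one]
    split_ifs
    · exact isAlgebraic_one
    · exact isAlgebraic_zero
  · intro k
    rw [Polynomial.coeff_zero]
    exact isAlgebraic_zero
  · intro ϖ hϖ
    rw [hid ϖ hϖ, hGK ϖ hϖ]
    simp

/-- **The rung from the registered stubs, by name.** [cite: KontsevichZagier2001, §1.2] -/
theorem DilationLiftAtOneDimOne_of : DilationLiftAtOneDimOne :=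
  DilationLiftAtOneDimOne_of_stubs stub_nullLoopFactorisation stub_straightPathKernel
    Summit.KontsevichZagierPeriods.LiftingCriteria.DilationLiftAtOne.stub_twistedDiagonal

/-- **Decomposition theorem (explicit hypotheses = the four stub statements, no `sorry`).**
Normal form (S1), local purity at `1` (S2), glue (S3) and the twisted-diagonal device (S4) give the
crux with witness `T = 1`, `d = d + 1`, `G`, `μ = 1`, `μ₀ = 0`. The conclusion is the crux UNFOLDED
verbatim (the body of the route decl), so that exactly one theorem of this file, `DilationLiftAtOne_of`,
concludes the crux by its route name (skeleton audit). [cite: KontsevichZagier2001, §1.2] -/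
theorem DilationLiftAtOne_of_stubs
    (h₁ : ∀ (S : ℕ) (n : Fin S → ℕ) (g : (i : Fin S) → (Fin (n i) → ℝ) → ℝ) (U : (i : Fin S) → Set (Fin (n i) → ℝ)), (∀ i, IsOpen (U i) ∧ Set.pi Set.univ (fun _ : Fin (n i) => Set.Icc (0:ℝ) 1) ⊆ (U i) ∧ Literature.NumberTheory.Transcendental.IsSemialgebraicFunOn ℚ (U i) (g i) ∧ AnalyticOnNhd ℝ (g i) (U i)) → ∀ (m : Fin S → ℤ) (m₀ : ℤ), ∃ (N : ℕ) (h : (Fin N → ℝ) → ℝ) (W : Set (Fin N → ℝ)), (IsOpen W ∧ Set.pi Set.univ (fun _ : Fin N => Set.Icc (0:ℝ) 1) ⊆ W ∧ Literature.NumberTheory.Transcendental.IsSemialgebraicFunOn ℚ W h ∧ AnalyticOnNhd ℝ h W) ∧ ∀ ϖ ∈ Set.Icc (0:ℝ) 1, (m₀ : ℝ) + ∑ i, (m i : ℝ) * (∫ z in Set.pi Set.univ (fun _ : Fin (n i) => Set.Icc (0:ℝ) 1), g i (ϖ • z)) = ∫ z in Set.pi Set.univ (fun _ : Fin N => Set.Icc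 (0:ℝ) 1), h (ϖ • z))
    (h₂ : ∀ (N : ℕ) (h : (Fin N → ℝ) → ℝ) (W : Set (Fin N → ℝ)), IsOpen W → Set.pi Set.univ (fun _ : Fin N => Set.Icc (0:ℝ) 1) ⊆ W → Literature.NumberTheory.Transcendental.IsSemialgebraicFunOn ℚ W h → AnalyticOnNhd ℝ h W → (∫ z in Set.pi Set.univ (fun _ : Fin N => Set.Icc (0:ℝ) 1), h ((1:ℝ) • z)) = 0 → ∃ (ε : ℝ) (d₁ : ℕ) (K₁ : (Fin (d₁ + 1) → ℝ) → ℝ) (V₁ : Set (Fin (d₁ + 1) → ℝ)), 0 < ε ∧ IsOpen V₁ ∧ (∀ ϖ ∈ Set.Ioc (1 - ε) 1, ∀ x ∈ Set.pi Set.univ (fun _ : Fin d₁ => Set.Icc (0:ℝ) 1), Matrix.vecCons ϖ x ∈ V₁) ∧ Literature.NumberTheory.Transcendental.IsSemialgebraicFunOn ℚ V₁ K₁ ∧ AnalyticOnNhd ℝ K₁ V₁ ∧ ∀ ϖ ∈ Set.Ioc (1 - ε) 1, (∫ z in Set.pi Set.univ (fun _ : Fin N => Set.Icc (0:ℝ)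 1), h (ϖ • z)) = (ϖ - 1) * ∫ y in Set.pi Set.univ (fun _ : Fin d₁ => Set.Icc (0:ℝ) 1), K₁ (Matrix.vecCons ϖ (ϖ • y)))
    (h₃ : ∀ (N : ℕ) (h : (Fin N → ℝ) → ℝ) (W : Set (Fin N → ℝ)), IsOpen W → Set.pi Set.univ (fun _ : Fin N => Set.Icc (0:ℝ) 1) ⊆ W → Literature.NumberTheory.Transcendental.IsSemialgebraicFunOn ℚ W h → AnalyticOnNhd ℝ h W → ∀ (ε : ℝ) (d₁ : ℕ) (K₁ : (Fin (d₁ + 1) → ℝ) → ℝ) (V₁ : Set (Fin (d₁ + 1) → ℝ)), 0 < ε → IsOpen V₁ → (∀ ϖ ∈ Set.Ioc (1 - ε) 1, ∀ x ∈ Set.pi Set.univ (fun _ : Fin d₁ => Set.Icc (0:ℝ) 1), Matrix.vecCons ϖ x ∈ V₁) → Literature.NumberTheory.Transcendental.IsSemialgebraicFunOn ℚ V₁ K₁ → AnalyticOnNhd ℝ K₁ V₁ → (∀ ϖ ∈ Set.Ioc (1 - ε) 1, (∫ z in Set.pi Set.univ (fun _ : Fin N => Set.Icc (0:ℝ) 1),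 h (ϖ • z)) = (ϖ - 1) * ∫ y in Set.pi Set.univ (fun _ : Fin d₁ => Set.Icc (0:ℝ) 1), K₁ (Matrix.vecCons ϖ (ϖ • y))) → ∃ (d : ℕ) (K : (Fin (d + 1) → ℝ) → ℝ) (V : Set (Fin (d + 1) → ℝ)), IsOpen V ∧ (∀ ϖ ∈ Set.Icc (0:ℝ) 1, ∀ x ∈ Set.pi Set.univ (fun _ : Fin d => Set.Icc (0:ℝ) 1), Matrix.vecCons ϖ x ∈ V) ∧ Literature.NumberTheory.Transcendental.IsSemialgebraicFunOn ℚ V K ∧ AnalyticOnNhd ℝ K V ∧ ∀ ϖ ∈ Set.Icc (0:ℝ) 1, (∫ z in Set.pi Set.univ (fun _ : Fin N => Set.Icc (0:ℝ) 1), h (ϖ • z)) = (ϖ - 1) * ∫ y in Set.pi Set.univ (fun _ : Fin d => Set.Icc (0:ℝ) 1), K (Matrix.vecCons ϖ (ϖ • y)))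
    (h₄ : ∀ (d : ℕ) (K : (Fin (d + 1) → ℝ) → ℝ) (V : Set (Fin (d + 1) → ℝ)), IsOpen V → (∀ ϖ ∈ Set.Icc (0:ℝ) 1, ∀ x ∈ Set.pi Set.univ (fun _ : Fin d => Set.Icc (0:ℝ) 1), Matrix.vecCons ϖ x ∈ V) → Literature.NumberTheory.Transcendental.IsSemialgebraicFunOn ℚ V K → AnalyticOnNhd ℝ K V → ∃ (G : (Fin (d + 1) → ℝ) → ℝ) (V' : Set (Fin (d + 1) → ℝ)), (IsOpen V' ∧ Set.pi Set.univ (fun _ : Fin (d + 1) => Set.Icc (0:ℝ) 1) ⊆ V' ∧ Literature.NumberTheory.Transcendental.IsSemialgebraicFunOn ℚ V' G ∧ AnalyticOnNhd ℝ G V') ∧ ∀ ϖ ∈ Set.Icc (0:ℝ) 1, (∫ y in Set.pi Set.univ (fun _ : Fin d => Set.Icc (0:ℝ) 1), K (Matrix.vecCons ϖ (ϖ • y))) = ∫ y' in Set.pi Set.univ (fun _ : Fin (d + 1) => Set.Icc (0:ℝ) 1), G (ϖ • y')) :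
    ∀ (S : ℕ) (n : Fin S → ℕ) (g : (i : Fin S) → (Fin (n i) → ℝ) → ℝ) (U : (i : Fin S) → Set (Fin (n i) → ℝ)), (∀ i, IsOpen (U i) ∧ Set.pi Set.univ (fun _ : Fin (n i) => Set.Icc (0:ℝ) 1) ⊆ (U i) ∧ Literature.NumberTheory.Transcendental.IsSemialgebraicFunOn ℚ (U i) (g i) ∧ AnalyticOnNhd ℝ (g i) (U i)) → ∀ (m : Fin S → ℤ) (m₀ : ℤ), (m₀ : ℝ) + ∑ i, (m i : ℝ) * (∫ z in Set.pi Set.univ (fun _ : Fin (n i) => Set.Icc (0:ℝ) 1), g i ((1:ℝ) • z)) = 0 → ∃ (T : ℕ) (d : Fin T → ℕ) (G : (j : Fin T) → (Fin (d j) → ℝ) → ℝ) (V : (j : Fin T) → Set (Fin (d j) → ℝ)) (μ : Fin T → Polynomial ℝ) (μ₀ : Polynomial ℝ), (∀ j, IsOpen (V j) ∧ Set.pi Set.univ (fun _ : Fin (d j) => Set.Icc (0:ℝ) 1) ⊆ (V j) ∧ Literature.NumberTheory.Transcendental.IsSemialgebraicFunOn ℚ (V j) (G j) ∧ AnalyticOnNhd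 ℝ (G j) (V j)) ∧ (∀ j k, IsAlgebraic ℚ ((μ j).coeff k)) ∧ (∀ k, IsAlgebraic ℚ (μ₀.coeff k)) ∧ ∀ ϖ ∈ Set.Icc (0:ℝ) 1, (m₀ : ℝ) + ∑ i, (m i : ℝ) * (∫ z in Set.pi Set.univ (fun _ : Fin (n i) => Set.Icc (0:ℝ) 1), g i (ϖ • z)) = (ϖ - 1) * (μ₀.eval ϖ + ∑ j, (μ j).eval ϖ * (∫ z in Set.pi Set.univ (fun _ : Fin (d j) => Set.Icc (0:ℝ) 1), G j (ϖ • z))) := by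
  intro S n g U hg m m₀ hsum
  -- (S1) one Nash cube function `h` with `m₀ + Σ mᵢ v_{gᵢ} = v_h` on `[0,1]`
  obtain ⟨N, h, W, ⟨hWo, hWc, hWs, hWa⟩, hv⟩ := h₁ S n g U hg m m₀
  -- the numerical relation at `ϖ = 1` is `v_h(1) = 0`
  have h1 : (∫ z in Set.pi Set.univ (fun _ : Fin N => Set.Icc (0:ℝ) 1), h ((1:ℝ) • z)) = 0 := by
    rw [← hv 1 ⟨zero_le_one, le_rfl⟩]
    exact hsum
  -- (S2) local factorisation through a twisted-diagonal kernel near `ϖ = 1`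
  obtain ⟨ε, d₁, K₁, V₁, hε, hV₁o, hV₁c, hK₁s, hK₁a, hloc⟩ := h₂ N h W hWo hWc hWs hWa h1
  -- (S3) glue: one kernel on all of `[0,1]`
  obtain ⟨d, K, V, hVo, hVc, hKs, hKa, hglob⟩ :=
    h₃ N h W hWo hWc hWs hWa ε d₁ K₁ V₁ hε hV₁o hV₁c hK₁s hK₁a hloc
  -- (S4) the twisted-diagonal integral is one dilation function `v_G`
  obtain ⟨G, V', hG, hGK⟩ := h₄ d K V hVo hVc hKs hKa
  refine ⟨1, fun _ => d + 1, fun _ => G, fun _ => V', fun _ => 1, 0, fun _ => hG, ?_, ?_, ?_⟩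
  · intro j k
    rw [Polynomial.coeff_one]
    split_ifs
    · exact isAlgebraic_one
    · exact isAlgebraic_zero
  · intro k
    rw [Polynomial.coeff_zero]
    exact isAlgebraic_zero
  · intro ϖ hϖ
    rw [hv ϖ hϖ, hglob ϖ hϖ, hGK ϖ hϖ]
    simp

/-- **Dispatch.** If the integer combination's dilation function is that of ONE one-variable Nash
datum `h` on some `(a,b) ⊇ [0,1]` (all dimension-one families: `h = m₀ + Σ mᵢ gᵢ`), the rung settles
it; otherwise S1, S2, the bet S3 and S4 as in line `registered`. [cite: KontsevichZagier2001, §1.2] -/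
theorem DilationLiftAtOne_of_rung_and_stubs (hR : DilationLiftAtOneDimOne)
    (h₁ : ∀ (S : ℕ) (n : Fin S → ℕ) (g : (i : Fin S) → (Fin (n i) → ℝ) → ℝ) (U : (i : Fin S) → Set (Fin (n i) → ℝ)), (∀ i, IsOpen (U i) ∧ Set.pi Set.univ (fun _ : Fin (n i) => Set.Icc (0:ℝ) 1) ⊆ (U i) ∧ Literature.NumberTheory.Transcendental.IsSemialgebraicFunOn ℚ (U i) (g i) ∧ AnalyticOnNhd ℝ (g i) (U i)) → ∀ (m : Fin S → ℤ) (m₀ : ℤ), ∃ (N : ℕ) (h : (Fin N → ℝ) → ℝ) (W : Set (Fin N → ℝ)), (IsOpen W ∧ Set.pi Set.univ (fun _ : Fin N => Set.Icc (0:ℝ) 1) ⊆ W ∧ Literature.NumberTheory.Transcendental.IsSemialgebraicFunOn ℚ W h ∧ AnalyticOnNhd ℝ h W) ∧ ∀ ϖ ∈ Set.Icc (0:ℝ) 1, (m₀ : ℝ) + ∑ i, (m i : ℝ) * (∫ z in Set.pi Set.univ (fun _ : Fin (n i) => Set.Icc (0:ℝ) 1), g i (ϖ • z)) = ∫ z in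 Set.pi Set.univ (fun _ : Fin N => Set.Icc (0:ℝ) 1), h (ϖ • z))
    (h₂ : ∀ (N : ℕ) (h : (Fin N → ℝ) → ℝ) (W : Set (Fin N → ℝ)), IsOpen W → Set.pi Set.univ (fun _ : Fin N => Set.Icc (0:ℝ) 1) ⊆ W → Literature.NumberTheory.Transcendental.IsSemialgebraicFunOn ℚ W h → AnalyticOnNhd ℝ h W → (∫ z in Set.pi Set.univ (fun _ : Fin N => Set.Icc (0:ℝ) 1), h ((1:ℝ) • z)) = 0 → ∃ (ε : ℝ) (d₁ : ℕ) (K₁ : (Fin (d₁ + 1) → ℝ) → ℝ) (V₁ : Set (Fin (d₁ + 1) → ℝ)), 0 < ε ∧ IsOpen V₁ ∧ (∀ ϖ ∈ Set.Ioc (1 - ε) 1, ∀ x ∈ Set.pi Set.univ (fun _ : Fin d₁ => Set.Icc (0:ℝ) 1), Matrix.vecCons ϖ x ∈ V₁) ∧ Literature.NumberTheory.Transcendental.IsSemialgebraicFunOn ℚ V₁ K₁ ∧ AnalyticOnNhd ℝ K₁ V₁ ∧ ∀ ϖ ∈ Set.Ioc (1 - ε) 1, (∫ z in Set.pi Set.univ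 (fun _ : Fin N => Set.Icc (0:ℝ) 1), h (ϖ • z)) = (ϖ - 1) * ∫ y in Set.pi Set.univ (fun _ : Fin d₁ => Set.Icc (0:ℝ) 1), K₁ (Matrix.vecCons ϖ (ϖ • y)))
    (h₃ : ∀ (N : ℕ) (h : (Fin N → ℝ) → ℝ) (W : Set (Fin N → ℝ)), IsOpen W → Set.pi Set.univ (fun _ : Fin N => Set.Icc (0:ℝ) 1) ⊆ W → Literature.NumberTheory.Transcendental.IsSemialgebraicFunOn ℚ W h → AnalyticOnNhd ℝ h W → ∀ (ε : ℝ) (d₁ : ℕ) (K₁ : (Fin (d₁ + 1) → ℝ) → ℝ) (V₁ : Set (Fin (d₁ + 1) → ℝ)), 0 < ε → IsOpen V₁ → (∀ ϖ ∈ Set.Ioc (1 - ε) 1, ∀ x ∈ Set.pi Set.univ (fun _ : Fin d₁ => Set.Icc (0:ℝ) 1), Matrix.vecCons ϖ x ∈ V₁) → Literature.NumberTheory.Transcendental.IsSemialgebraicFunOn ℚ V₁ K₁ → AnalyticOnNhd ℝ K₁ V₁ → (∀ ϖ ∈ Set.Ioc (1 - ε) 1, (∫ z in Set.pi Set.univ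 (fun _ : Fin N => Set.Icc (0:ℝ) 1), h (ϖ • z)) = (ϖ - 1) * ∫ y in Set.pi Set.univ (fun _ : Fin d₁ => Set.Icc (0:ℝ) 1), K₁ (Matrix.vecCons ϖ (ϖ • y))) → ∃ (d : ℕ) (K : (Fin (d + 1) → ℝ) → ℝ) (V : Set (Fin (d + 1) → ℝ)), IsOpen V ∧ (∀ ϖ ∈ Set.Icc (0:ℝ) 1, ∀ x ∈ Set.pi Set.univ (fun _ : Fin d => Set.Icc (0:ℝ) 1), Matrix.vecCons ϖ x ∈ V) ∧ Literature.NumberTheory.Transcendental.IsSemialgebraicFunOn ℚ V K ∧ AnalyticOnNhd ℝ K V ∧ ∀ ϖ ∈ Set.Icc (0:ℝ) 1, (∫ z in Set.pi Set.univ (fun _ : Fin N => Set.Icc (0:ℝ) 1), h (ϖ • z)) = (ϖ - 1) * ∫ y in Set.pi Set.univ (fun _ : Fin d => Set.Icc (0:ℝ) 1), K (Matrix.vecCons ϖ (ϖ • y)))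
    (h₄ : ∀ (d : ℕ) (K : (Fin (d + 1) → ℝ) → ℝ) (V : Set (Fin (d + 1) → ℝ)), IsOpen V → (∀ ϖ ∈ Set.Icc (0:ℝ) 1, ∀ x ∈ Set.pi Set.univ (fun _ : Fin d => Set.Icc (0:ℝ) 1), Matrix.vecCons ϖ x ∈ V) → Literature.NumberTheory.Transcendental.IsSemialgebraicFunOn ℚ V K → AnalyticOnNhd ℝ K V → ∃ (G : (Fin (d + 1) → ℝ) → ℝ) (V' : Set (Fin (d + 1) → ℝ)), (IsOpen V' ∧ Set.pi Set.univ (fun _ : Fin (d + 1) => Set.Icc (0:ℝ) 1) ⊆ V' ∧ Literature.NumberTheory.Transcendental.IsSemialgebraicFunOn ℚ V' G ∧ AnalyticOnNhd ℝ G V') ∧ ∀ ϖ ∈ Set.Icc (0:ℝ) 1, (∫ y in Set.pi Set.univ (fun _ : Fin d => Set.Icc (0:ℝ) 1), K (Matrix.vecCons ϖ (ϖ • y))) = ∫ y' in Set.pi Set.univ (fun _ : Fin (d + 1) => Set.Icc (0:ℝ) 1), G (ϖ • y')) :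
    DilationLiftAtOne := by
  intro S n g U hg m m₀ hsum
  classical
  by_cases hP : ∃ (a b : ℝ) (h : ℝ → ℝ), a < 0 ∧ 1 < b ∧
      Literature.NumberTheory.Transcendental.IsSemialgebraicFunOn ℚ {t : Fin 1 → ℝ | t 0 ∈ Set.Ioo a b} (fun t => h (t 0)) ∧
      (∀ x ∈ Set.Ioo a b, AnalyticAt ℝ h x) ∧
      ∀ ϖ ∈ Set.Icc (0:ℝ) 1, (m₀ : ℝ) + ∑ i, (m i : ℝ) *
          (∫ z in Set.pi Set.univ (fun _ : Fin (n i) => Set.Icc (0:ℝ) 1), g i (ϖ • z)) =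
        ∫ z in Set.pi Set.univ (fun _ : Fin 1 => Set.Icc (0:ℝ) 1), h ((ϖ • z) 0)
  · obtain ⟨a, b, h, ha, hb, hs, han, hrepr⟩ := hP
    have h1 : (∫ z in Set.pi Set.univ (fun _ : Fin 1 => Set.Icc (0:ℝ) 1), h (((1:ℝ) • z) 0)) = 0 := by
      rw [← hrepr 1 ⟨zero_le_one, le_rfl⟩]
      exact hsum
    obtain ⟨T, d, G, V, μ, μ₀, hG, hμ, hμ₀, hid⟩ := hR a b ha hb h trivial hs han h1
    refine ⟨T, d, G, V, μ, μ₀, hG, hμ, hμ₀, ?_⟩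
    intro ϖ hϖ
    rw [hrepr ϖ hϖ]
    exact hid ϖ hϖ
  · exact DilationLiftAtOne_of_stubs h₁ h₂ h₃ h₄ S n g U hg m m₀ hsum

/-- **The crux from the registered stubs, BY NAME** (the skeleton theorem audited by
`ledger skeleton check`): sorries only in `stub_nullLoopFactorisation`, `stub_straightPathKernel`
(the dimension-one rung) and `stub_glueAtOne` (the bet = dimension ≥ 2). [cite: KontsevichZagier2001, §1.2] -/
theorem DilationLiftAtOne_of : DilationLiftAtOne :=
  DilationLiftAtOne_of_rung_and_stubs DilationLiftAtOneDimOne_of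
    Summit.KontsevichZagierPeriods.LiftingCriteria.DilationLiftAtOne.stub_singleGenerator
    Summit.KontsevichZagierPeriods.LiftingCriteria.DilationLiftAtOne.stub_localPurityAtOne stub_glueAtOne
    Summit.KontsevichZagierPeriods.LiftingCriteria.DilationLiftAtOne.stub_twistedDiagonal

/-! ### Ladder certificates (no `sorry`): on-path `crux → rung`, and the floor `θ₀` of the family -/

/-- **On-path certificate: the crux implies the rung** (instantiate with `S = 1`, `n = 1`,
`g = fun t => h (t 0)`, `U = {t | t 0 ∈ (a,b)}`, `m = 1`, `m₀ = 0`). [cite: KontsevichZagier2001, §1.2] -/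
theorem dimOne_of_dilationLiftAtOne (hL : DilationLiftAtOne) : DilationLiftAtOneDimOne := by
  intro a b ha hb h _ hs han h1
  have hUo : IsOpen {t : Fin 1 → ℝ | t 0 ∈ Set.Ioo a b} := isOpen_Ioo.preimage (continuous_apply 0)
  have hUc : Set.pi Set.univ (fun _ : Fin 1 => Set.Icc (0:ℝ) 1) ⊆ {t : Fin 1 → ℝ | t 0 ∈ Set.Ioo a b} := by
    intro t ht
    have h0 : t 0 ∈ Set.Icc (0:ℝ) 1 := ht 0 (Set.mem_univ _)
    exact ⟨ha.trans_le h0.1, h0.2.trans_lt hb⟩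
  have hUa : AnalyticOnNhd ℝ (fun t : Fin 1 → ℝ => h (t 0)) {t : Fin 1 → ℝ | t 0 ∈ Set.Ioo a b} := by
    intro t ht
    have h0 : AnalyticAt ℝ (fun p : Fin 1 → ℝ => p 0) t :=
      (ContinuousLinearMap.proj (R := ℝ) (φ := fun _ : Fin 1 => ℝ) 0).analyticAt t
    exact AnalyticAt.comp (f := fun q : Fin 1 → ℝ => q 0) (han (t 0) ht) h0
  have hsum : ((0:ℤ) : ℝ) + ∑ i : Fin 1, ((fun _ => (1:ℤ)) i : ℝ) *
      (∫ z in Set.pi Set.univ (fun _ : Fin 1 => Set.Icc (0:ℝ) 1), (fun (_ : Fin 1) (t : Fin 1 → ℝ) => h (t 0)) i (((1:ℝ) • z))) = 0 := by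
    simpa using h1
  obtain ⟨T, d, G, V, μ, μ₀, hG, hμ, hμ₀, hid⟩ :=
    hL 1 (fun _ => 1) (fun _ t => h (t 0)) (fun _ => {t : Fin 1 → ℝ | t 0 ∈ Set.Ioo a b})
      (fun _ => ⟨hUo, hUc, hs, hUa⟩) (fun _ => 1) 0 hsum
  refine ⟨T, d, G, V, μ, μ₀, hG, hμ, hμ₀, ?_⟩
  intro ϖ hϖ
  have := hid ϖ hϖ
  simpa using this

/-- **Floor `θ₀` of the family (PROVED rung, = the witness of F3/BC5): Liouville data lift**, a thin
repackaging of the landed `dilationLiftAtOne_liouvilleSector` (p166809; Baker's theorem on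
differences of logarithms, sorry-free in the tree). [cite: Baker1975, Thm. 2.1] -/
theorem dimOneLiftOn_liouville : DimOneLiftOn IsLiouvilleData := by
  intro a b ha hb h hadm _ _ h1
  obtain ⟨N, A, u, v, γ, δ, hNs, hNa, hus, hvs, hua, hva, hslit, hγ, hδ, rfl⟩ := hadm
  have H := Summit.KontsevichZagierPeriods.LiftingCriteria.DilationLiftAtOne.dilationLiftAtOne_liouvilleSector
    a b ha hb N hNs hNa A u v hus hvs hua hva hslit γ δ hγ hδ 1 0 (by simpa using h1)
  simpa using H

end Summit.KontsevichZagierPeriods.KontsevichZagierPeriods.Cruxes.DilationLiftAtOne.DimOneAsgt
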